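import Summits.QuantumFields.YangMills.Theorems.BalabanUVNodesN19AnnealedRelative
import Summits.QuantumFields.YangMills.Theorems.BalabanUVNodesN19GaussianMarginal
import Summits.QuantumFields.YangMills.Theorems.BalabanUVNodesN19TiltPathKingModel

/-!
# BalabanUVNodes ∕ node N19 (NE7 bracket) → apex — LOCALITY OF THE NE7 REMAINDER IN KING'S GAUSSIAN MODEL: for an observable that sees the field only on a site set `X`,
# the matching-modulo-constants remainder is `(e^{2l₀B} − 1)·θ_{K+1}·a·|X|∕(2γ₀·vol)` — the support size `|X|`, NOT the volume `|Tor M|` of p518223 ∕ n14-c's King storeys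

Cell `pub-ymgap`, HUMAN RULING D-0062 (Track A), R134 ACCELERATION seat `pub-ymgap-dag-n19-c` (N19 NE7, strategy s1), generation 14, module 22c; route
`Summits/QuantumFields/YangMills/Theses/BalabanUVNodes.lean` rev 21 (K3⁵ `SpineGivenEndpointR13SepCoP` = stmt-QuantumFields-20296, `--supports … --as helper`); venue R424
(namespace `Summit.QuantumFields.YangMills.BalabanUVNodes.N19TiltPathKingModelLocal`).  ADDITIVE — imports this seat's modules 22a-II `…N19AnnealedRelative` (★★ the RELATIVE
two-run bound `abs_log_sub_log_sub_le_of_relClose`), 22b `…N19GaussianMarginal` (★★ marginalisation, Schur transfers, relabelling) and 19b `…N19TiltPathKingModel` (p518223, the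
VOLUME-dependent King storey this file sharpens; through it n14-c's `…N18KingModelLargeField` (`effLaplacian_coercive_unif`, `gamma0_pos`, `dressedZ_full_pos`),
`…KingModelDensTorus` (`abs_action_sub_le_torus_of_eq` = King's Prop. 3.10 (3.92) at the operators), `…KingModelDens` (`kingTheta_nonneg`, `summable_kingRadius`), the tree's
`King1986` files (`Torus.effLaplacian`, `aK`, `thetaK`, `aminL`), `T4CauchySum` and `Spine.NE7.Targets` (`Core`)) — all CITED; THEOREMS ONLY (0 `def`), modifies nothing.

WHY (bus INTENT-22 l.19008, door d17 LOCALITY; dag-lead DEDUP-277 GO).  Every King-storey NE7 statement in the tree carries the VOLUME: n14-c's `cauchy_genFun_kingTwoClass` ∕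
`…_kingGaussian` (large-field weight `e^{2l₀B}√2^{|Tor M|}e^{−γ₀R_K²∕4}`) and this seat's `matchingModConstants_kingFullSpace` (`δ_K = (e^{2l₀B} − 1)θ_{K+1}a·|Tor M|∕(2γ₀vol)`).
For a LOCAL observable — `W φ` depending on `φ|_X` only, as every unit-lattice observable of the programme does — the remainder must not see the torus: that is the
field-theoretic content of a UV-stability statement.  In the Gaussian model it follows from three elementary facts: the dressed partition function MARGINALISES to the
`|X|`-dimensional block with the Schur-complement precision (22b); Schur complements inherit coercivity and RELATIVE form-closeness with the same constants (22b §1); and the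
annealed road run with relative closeness pays the DIMENSION of the space it runs on and nothing else (22a-II).  At King's letters the relative closeness of consecutive
effective Laplacians is `ε_K = θ_{K+1}a∕γ₀` (`relClose_king`), so `δ_K^{loc} = (e^{2l₀B} − 1)·θ_{K+1}a·|X|∕(2γ₀vol)` — p518223's constant with `|Tor M| ↦ |X|`, uniformly in `M`.
* §1 [folklore] ★★ **`abs_log_sub_log_sub_le_local`** — generic: two `γ`-coercive, `(1+ε)`-sandwiched forms on `ι`, a splitting `e : m ⊕ n ≃ ι`, an observable seeing the
  `m`-block only ⇒ `|Δlog Z(t) − Δlog Z(0)| ≤ (e^{2|t|B} − 1)·ε·|m|∕2`.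
* §2 King's letters: `measurable_comp_extend`, `local_read_sumCompl` (locality through `Equiv.sumCompl (· ∈ X)`), ★ `relClose_king`, ★★ **`abs_log_sub_log_sub_le_kingLocal`**,
  ★★ `matchingModConstants_kingLocal`, `summable_delta_kingLocal`, `target_kingLocal` (`Spine.NE7.Target` by name), ★★★ **`cauchy_genFun_kingLocal`** (NE7 + `Σδ < ∞` + Cauchy + uniform convergence on the window with the
  volume-free `δ`), `cauchy_genFun_kingLocal_cos_site` (A2 exhibited: `W = cos φ(x₀)`, `X = {x₀}`, model data only), ★ `core_kingLocal` (`Spine.NE7.Core`, one class, no bad class, volume-free `δ`), `exists_core_summable_kingLocal` (the K3 edge shape, with the explicit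
  volume-free majorant of `δ` displayed), ★ `hybridNE7_kingLocal` (`HybridNE7`, no fiat).

HONEST FRAMING.  King's `A = 0` scalar MODEL on one finite unit torus `Tor M` (template literature) + finite-dimensional Gaussian calculus [folklore]; the locality is that of
the MODEL's block structure, not a cluster expansion; NOT Bałaban's NE7 (NOT PRINTED as a two-run statement for d = 4; NODE O's objects); nothing of Bałaban's instantiated.
Count-neutral; N18 ∕ N19 ∕ N20 NOT discharged (N19 0∕1); K3⁵ NOT claimed; counts UNMOVED (typed 28∕28 · discharged 5∕27).  Everything PROVED (0 `sorry`, 0 named facts,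
standard axioms).  One finite four-torus programme at fixed ε; NOT ℝ⁴, NOT infinite volume, NOT OS, NOT a mass gap, NOT Clay.
-/

noncomputable section

namespace Summit.QuantumFields.YangMills.BalabanUVNodes.N19TiltPathKingModelLocal

open MeasureTheory Set Filter Real Matrix Topology
open scoped BigOperators
open Literature.MathematicalPhysics.QuantumFieldTheory.Balaban1983to89.QGQInverse (Coercive)
open Literature.MathematicalPhysics.QuantumFieldTheory.Balaban1983to89.B5Prop11Plancherel (Tor)
open Literature.MathematicalPhysics.QuantumFieldTheory.Balaban1983to89.T4CauchySum
  (MatchingModConstants genFun genFunLim cauchySeq_genFun tendstoUniformlyOn_genFun two_sided_of_abs_log_sub_le)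
open Literature.MathematicalPhysics.QuantumFieldTheory.King1986 (aK thetaK)
open Literature.MathematicalPhysics.QuantumFieldTheory.King1986.Torus (effLaplacian aminL)
open Literature.LinearAlgebra.Matrix (dotProduct_self_nonneg_real)
open Summit.QuantumFields.BalabanUV.T4Continuum.Spine.NE7 (Core Target)
open YMDAG.N18.KingModelDens (kingTheta_nonneg summable_kingRadius)
open YMDAG.N18.KingModelDensTorus (abs_action_sub_le_torus_of_eq)
open YMDAG.N18.KingModelLargeField (effLaplacian_coercive_unif gamma0_pos)
open YMDAG.N18.KingModelCauchy (relWeightBound_empty)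
open Literature.MathematicalPhysics.QuantumFieldTheory.Balaban1983to89.T4MatchingAssembly (HybridNE7 hybridNE7_noShell)
open Summit.QuantumFields.YangMills.BalabanUVNodes.N19AnnealedGeneric (dressedZ_pos)
open Summit.QuantumFields.YangMills.BalabanUVNodes.N19AnnealedRelative (abs_log_sub_log_sub_le_of_relClose)
open Summit.QuantumFields.YangMills.BalabanUVNodes.N19GaussianMarginal

/-! ## §1 Generic: the two-run bound for a LOCAL observable sees the number of kept sites only -/
section Local

variable {ι m n : Type*} [Fintype ι] [Fintype m] [Fintype n] [DecidableEq m] [DecidableEq n]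

/-- **★★ THE LOCAL ANNEALED TWO-RUN BOUND** [folklore ∘ modules 22a-II + 22b].  `Δ_A`, `Δ_B` real matrices on the finite index `ι`, both `γ`-coercive (`γ > 0`) and relatively
close as forms (`φ·Δ_Bφ ≤ (1+ε)·φ·Δ_Aφ`, `φ·Δ_Aφ ≤ (1+ε)·φ·Δ_Bφ`, `ε ≥ 0`); `e : m ⊕ n ≃ ι` a splitting of the sites; `W` bounded measurable on `ι → ℝ` seeing the KEPT
sites only — `W(v ∘ e⁻¹) = w(v ∘ inl)` for a measurable `w` on `m → ℝ` (the measurability of `W` itself is not needed: its integrals ARE the marginal ones).  Then the FULL-SPACE dressed partition functions `Z_Y(s) = ∫ e^{−½φ·Δ_Yφ}e^{sW(φ)}dφ` satisfy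
`|log Z_B(t) − log Z_A(t) − (log Z_B(0) − log Z_A(0))| ≤ (e^{2|t|B} − 1)·ε·|m|∕2` — the number of KEPT sites, not `|ι|`.
Road: symmetrise and relabel both forms into block forms `(A_Y B_Y; B_Yᵀ D_Y)`; marginalise (`integral_dressed_eq_marginal`: `Z_Y(s) = C_Y·Zᵐ_Y(s)`, the constants `C_Y` cancel
in the combination); the Schur forms are `γ`-coercive and `(1+ε)`-sandwiched like the full ones (`coercive_schur`, `schurForm_le_mul`); apply the RELATIVE two-run bound on `m → ℝ`. -/
theorem abs_log_sub_log_sub_le_local (e : m ⊕ n ≃ ι) {ΔA ΔB : Matrix ι ι ℝ} {γ ε B : ℝ} (hγ : 0 < γ) (hε : 0 ≤ ε)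
    (hcA : Coercive ΔA γ) (hcB : Coercive ΔB γ)
    (hAB : ∀ φ : ι → ℝ, φ ⬝ᵥ (ΔB *ᵥ φ) ≤ (1 + ε) * (φ ⬝ᵥ (ΔA *ᵥ φ)))
    (hBA : ∀ φ : ι → ℝ, φ ⬝ᵥ (ΔA *ᵥ φ) ≤ (1 + ε) * (φ ⬝ᵥ (ΔB *ᵥ φ)))
    {W : (ι → ℝ) → ℝ} (hWb : ∀ φ, |W φ| ≤ B) {w : (m → ℝ) → ℝ} (hwm : Measurable w)
    (hWw : ∀ v : m ⊕ n → ℝ, W (fun a => v (e.symm a)) = w (fun i => v (Sum.inl i))) (t : ℝ) :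
    |Real.log (∫ φ : ι → ℝ, Real.exp (-(φ ⬝ᵥ (ΔB *ᵥ φ) / 2)) * Real.exp (t * W φ))
        - Real.log (∫ φ : ι → ℝ, Real.exp (-(φ ⬝ᵥ (ΔA *ᵥ φ) / 2)) * Real.exp (t * W φ))
        - (Real.log (∫ φ : ι → ℝ, Real.exp (-(φ ⬝ᵥ (ΔB *ᵥ φ) / 2)) * Real.exp (0 * W φ))
            - Real.log (∫ φ : ι → ℝ, Real.exp (-(φ ⬝ᵥ (ΔA *ᵥ φ) / 2)) * Real.exp (0 * W φ)))|
      ≤ (Real.exp (2 * (|t| * B)) - 1) * ε * Fintype.card m / 2 := by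
  -- `w` is bounded like `W`
  have hwb : ∀ x : m → ℝ, |w x| ≤ B := fun x => by
    have h := hWw (Sum.elim x 0)
    simp only [Sum.elim_inl] at h
    rw [← h]
    exact hWb _
  -- symmetrise and relabel
  set ΔA' : Matrix (m ⊕ n) (m ⊕ n) ℝ := ((1 / 2 : ℝ) • (ΔA + ΔAᵀ)).submatrix e e with hΔA'
  set ΔB' : Matrix (m ⊕ n) (m ⊕ n) ℝ := ((1 / 2 : ℝ) • (ΔB + ΔBᵀ)).submatrix e e with hΔB'
  have hsA : ΔA'ᵀ = ΔA' := submatrix_transpose_of_transpose_eq (symmetrize_transpose ΔA) e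
  have hsB : ΔB'ᵀ = ΔB' := submatrix_transpose_of_transpose_eq (symmetrize_transpose ΔB) e
  obtain ⟨hblkA, hDA⟩ := eq_fromBlocks_of_transpose_eq hsA
  obtain ⟨hblkB, hDB⟩ := eq_fromBlocks_of_transpose_eq hsB
  have hqA : ∀ v : m ⊕ n → ℝ, (fun a => v (e.symm a)) ⬝ᵥ (ΔA *ᵥ fun a => v (e.symm a))
      = v ⬝ᵥ (fromBlocks ΔA'.toBlocks₁₁ ΔA'.toBlocks₁₂ ΔA'.toBlocks₁₂ᵀ ΔA'.toBlocks₂₂ *ᵥ v) := fun v => by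
    rw [← hblkA, hΔA', ← quadForm_reindex, quadForm_symmetrize]
  have hqB : ∀ v : m ⊕ n → ℝ, (fun a => v (e.symm a)) ⬝ᵥ (ΔB *ᵥ fun a => v (e.symm a))
      = v ⬝ᵥ (fromBlocks ΔB'.toBlocks₁₁ ΔB'.toBlocks₁₂ ΔB'.toBlocks₁₂ᵀ ΔB'.toBlocks₂₂ *ᵥ v) := fun v => by
    rw [← hblkB, hΔB', ← quadForm_reindex, quadForm_symmetrize]
  -- coercivity and the relative sandwich in block form
  have hcA' : Coercive (fromBlocks ΔA'.toBlocks₁₁ ΔA'.toBlocks₁₂ ΔA'.toBlocks₁₂ᵀ ΔA'.toBlocks₂₂) γ := fun v => by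
    rw [← hqA, ← dotProduct_self_reindex e v]; exact hcA _
  have hcB' : Coercive (fromBlocks ΔB'.toBlocks₁₁ ΔB'.toBlocks₁₂ ΔB'.toBlocks₁₂ᵀ ΔB'.toBlocks₂₂) γ := fun v => by
    rw [← hqB, ← dotProduct_self_reindex e v]; exact hcB _
  have hAB' : ∀ v : m ⊕ n → ℝ, v ⬝ᵥ (fromBlocks ΔB'.toBlocks₁₁ ΔB'.toBlocks₁₂ ΔB'.toBlocks₁₂ᵀ ΔB'.toBlocks₂₂ *ᵥ v)
      ≤ (1 + ε) * (v ⬝ᵥ (fromBlocks ΔA'.toBlocks₁₁ ΔA'.toBlocks₁₂ ΔA'.toBlocks₁₂ᵀ ΔA'.toBlocks₂₂ *ᵥ v)) := fun v => by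
    rw [← hqA, ← hqB]; exact hAB _
  have hBA' : ∀ v : m ⊕ n → ℝ, v ⬝ᵥ (fromBlocks ΔA'.toBlocks₁₁ ΔA'.toBlocks₁₂ ΔA'.toBlocks₁₂ᵀ ΔA'.toBlocks₂₂ *ᵥ v)
      ≤ (1 + ε) * (v ⬝ᵥ (fromBlocks ΔB'.toBlocks₁₁ ΔB'.toBlocks₁₂ ΔB'.toBlocks₁₂ᵀ ΔB'.toBlocks₂₂ *ᵥ v)) := fun v => by
    rw [← hqA, ← hqB]; exact hBA _
  have hpdA : ΔA'.toBlocks₂₂.PosDef := posDef_of_coercive hγ (coercive_toBlock₂₂ hcA') hDA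
  have hpdB : ΔB'.toBlocks₂₂.PosDef := posDef_of_coercive hγ (coercive_toBlock₂₂ hcB') hDB
  -- the Schur forms: coercive and relatively close
  have hSA : Coercive (ΔA'.toBlocks₁₁ - ΔA'.toBlocks₁₂ * (ΔA'.toBlocks₂₂)⁻¹ * ΔA'.toBlocks₁₂ᵀ) γ := coercive_schur hγ.le hpdA hcA'
  have hSB : Coercive (ΔB'.toBlocks₁₁ - ΔB'.toBlocks₁₂ * (ΔB'.toBlocks₂₂)⁻¹ * ΔB'.toBlocks₁₂ᵀ) γ := coercive_schur hγ.le hpdB hcB'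
  have hSAB := schurForm_le_mul hpdA hpdB hAB'
  have hSBA := schurForm_le_mul hpdB hpdA hBA'
  -- marginalisation of the four partition functions
  have hmA : ∀ s : ℝ, ∫ φ : ι → ℝ, Real.exp (-(φ ⬝ᵥ (ΔA *ᵥ φ) / 2)) * Real.exp (s * W φ)
      = (∫ y : n → ℝ, Real.exp (-(y ⬝ᵥ (ΔA'.toBlocks₂₂ *ᵥ y) / 2)))
        * ∫ x : m → ℝ, Real.exp (-(x ⬝ᵥ ((ΔA'.toBlocks₁₁ - ΔA'.toBlocks₁₂ * (ΔA'.toBlocks₂₂)⁻¹ * ΔA'.toBlocks₁₂ᵀ) *ᵥ x) / 2)) * Real.exp (s * w x) :=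
    fun s => integral_dressed_eq_marginal e hqA hDA hγ hcA' hWw hwm hwb s
  have hmB : ∀ s : ℝ, ∫ φ : ι → ℝ, Real.exp (-(φ ⬝ᵥ (ΔB *ᵥ φ) / 2)) * Real.exp (s * W φ)
      = (∫ y : n → ℝ, Real.exp (-(y ⬝ᵥ (ΔB'.toBlocks₂₂ *ᵥ y) / 2)))
        * ∫ x : m → ℝ, Real.exp (-(x ⬝ᵥ ((ΔB'.toBlocks₁₁ - ΔB'.toBlocks₁₂ * (ΔB'.toBlocks₂₂)⁻¹ * ΔB'.toBlocks₁₂ᵀ) *ᵥ x) / 2)) * Real.exp (s * w x) :=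
    fun s => integral_dressed_eq_marginal e hqB hDB hγ hcB' hWw hwm hwb s
  have hCA : 0 < ∫ y : n → ℝ, Real.exp (-(y ⬝ᵥ (ΔA'.toBlocks₂₂ *ᵥ y) / 2)) := integral_exp_neg_toBlock₂₂_pos hγ hcA'
  have hCB : 0 < ∫ y : n → ℝ, Real.exp (-(y ⬝ᵥ (ΔB'.toBlocks₂₂ *ᵥ y) / 2)) := integral_exp_neg_toBlock₂₂_pos hγ hcB'
  have hZA : ∀ s : ℝ, 0 < ∫ x : m → ℝ, Real.exp (-(x ⬝ᵥ ((ΔA'.toBlocks₁₁ - ΔA'.toBlocks₁₂ * (ΔA'.toBlocks₂₂)⁻¹ * ΔA'.toBlocks₁₂ᵀ) *ᵥ x) / 2))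
      * Real.exp (s * w x) := fun s => dressedZ_pos hγ hSA hwm hwb s
  have hZB : ∀ s : ℝ, 0 < ∫ x : m → ℝ, Real.exp (-(x ⬝ᵥ ((ΔB'.toBlocks₁₁ - ΔB'.toBlocks₁₂ * (ΔB'.toBlocks₂₂)⁻¹ * ΔB'.toBlocks₁₂ᵀ) *ᵥ x) / 2))
      * Real.exp (s * w x) := fun s => dressedZ_pos hγ hSB hwm hwb s
  -- the constants cancel; the marginal two-run bound
  have key := abs_log_sub_log_sub_le_of_relClose hγ hε hSA hSB hSAB hSBA hwm hwb t
  have hlog : ∀ {C P Q R S' : ℝ}, 0 < C → ∀ {C' : ℝ}, 0 < C' → 0 < P → 0 < Q → 0 < R → 0 < S' →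
      Real.log (C' * P) - Real.log (C * Q) - (Real.log (C' * R) - Real.log (C * S'))
        = Real.log P - Real.log Q - (Real.log R - Real.log S') := by
    intro C P Q R S' hC C' hC' hP hQ hR hS'
    rw [Real.log_mul hC'.ne' hP.ne', Real.log_mul hC.ne' hQ.ne', Real.log_mul hC'.ne' hR.ne', Real.log_mul hC.ne' hS'.ne']
    ring
  rw [hmA t, hmB t, hmA 0, hmB 0, hlog hCA hCB (hZB t) (hZA t) (hZB 0) (hZA 0)]
  exact key

end Local

/-! ## §2 King's Gaussian model: a local observable's NE7 remainder sees `|X|`, not `|Tor M|` -/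
section King

variable {d : ℕ} (M : Fin d → ℕ) [hM : ∀ μ, NeZero (M μ)]
variable {l₀ vol B : ℝ} {W : (Tor M → ℝ) → ℝ} {Z : ℕ → ℝ → ℝ}

omit hM in
/-- The extension-by-zero of kept-site data to a field on `Tor M` is measurable, so a measurable `W` read through it is measurable on `X → ℝ`. [folklore] -/
theorem measurable_comp_extend (X : Finset (Tor M)) (hWm : Measurable W) :
    Measurable fun ψ : {x // x ∈ X} → ℝ => W (fun a => if h : a ∈ X then ψ ⟨a, h⟩ else 0) := by
  refine hWm.comp (measurable_pi_lambda _ fun a => ?_)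
  by_cases h : a ∈ X
  · simp only [h, dite_true]
    exact measurable_pi_apply _
  · simp only [h, dite_false]
    exact measurable_const

omit hM in
/-- A local observable read at a relabelled field only sees the kept block: with `e = Equiv.sumCompl (· ∈ X)`, `W(v ∘ e⁻¹) = W(extension by 0 of v ∘ inl)`. [folklore] -/
theorem local_read_sumCompl (X : Finset (Tor M)) (hWloc : ∀ φ ψ : Tor M → ℝ, (∀ x ∈ X, φ x = ψ x) → W φ = W ψ) (v : {x // x ∈ X} ⊕ {x // x ∉ X} → ℝ) :
    W (fun a => v ((Equiv.sumCompl fun x => x ∈ X).symm a)) = W (fun a => if h : a ∈ X then (fun i => v (Sum.inl i)) ⟨a, h⟩ else 0) := by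
  refine hWloc _ _ fun x hx => ?_
  simp only [hx, dite_true, Equiv.sumCompl_symm_apply_of_pos]

/-- King's consecutive effective Laplacians are RELATIVELY CLOSE as forms with `ε_K = θ_{K+1}·a∕γ₀` [King's Prop. 3.10 (3.92) at the operators, n14-c's `abs_action_sub_le_torus_of_eq`,
over the uniform coercivity `effLaplacian_coercive_unif`]: `φ·Δ^{(K+2)}φ ≤ (1 + θ_{K+1}a∕γ₀)·φ·Δ^{(K+1)}φ` and `φ·Δ^{(K+1)}φ ≤ (1 + θ_{K+1}a∕γ₀)·φ·Δ^{(K+2)}φ`.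
[cite: King1986, Prop 3.10 (3.91)–(3.92) p.669; (4.33)–(4.35) p.674] -/
theorem relClose_king {a : ℝ} (ha : 0 < a) {L : ℕ} [NeZero L] (hL : 2 ≤ L) {m2 : ℝ} (hm : 0 < m2) (K : ℕ) (φ : Tor M → ℝ) :
    φ ⬝ᵥ (effLaplacian (L ^ (K + 1 + 1)) M (aK a L (K + 1 + 1)) (((L ^ (K + 1 + 1) : ℕ) : ℝ) ^ 2) m2 *ᵥ φ)
        ≤ (1 + thetaK a L (K + 1) 1 * a / ((aminL a L)⁻¹ + m2⁻¹)⁻¹)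
          * (φ ⬝ᵥ (effLaplacian (L ^ (K + 1)) M (aK a L (K + 1)) (((L ^ (K + 1) : ℕ) : ℝ) ^ 2) m2 *ᵥ φ)) ∧
      φ ⬝ᵥ (effLaplacian (L ^ (K + 1)) M (aK a L (K + 1)) (((L ^ (K + 1) : ℕ) : ℝ) ^ 2) m2 *ᵥ φ)
        ≤ (1 + thetaK a L (K + 1) 1 * a / ((aminL a L)⁻¹ + m2⁻¹)⁻¹)
          * (φ ⬝ᵥ (effLaplacian (L ^ (K + 1 + 1)) M (aK a L (K + 1 + 1)) (((L ^ (K + 1 + 1) : ℕ) : ℝ) ^ 2) m2 *ᵥ φ)) := by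
  have hγ := gamma0_pos ha hL hm
  have hθ : 0 ≤ thetaK a L (K + 1) 1 * a := mul_nonneg (kingTheta_nonneg ha hL (by omega) le_rfl) ha.le
  have hdiff := abs_action_sub_le_torus_of_eq M ha hL (k := K + 1) (n := 1) (by omega) le_rfl hm (L ^ (K + 1 + 1))
    (by rw [pow_one, pow_succ, mul_comm]) (K + 1 + 1) rfl φ
  have hcA := effLaplacian_coercive_unif M ha hL (k := K + 1) (by omega) hm φ
  have hcB := effLaplacian_coercive_unif M ha hL (k := K + 1 + 1) (by omega) hm φ
  set γ₀ : ℝ := ((aminL a L)⁻¹ + m2⁻¹)⁻¹ with hγ₀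
  set θa : ℝ := thetaK a L (K + 1) 1 * a with hθa
  set A : ℝ := φ ⬝ᵥ (effLaplacian (L ^ (K + 1)) M (aK a L (K + 1)) (((L ^ (K + 1) : ℕ) : ℝ) ^ 2) m2 *ᵥ φ) with hA
  set Bq : ℝ := φ ⬝ᵥ (effLaplacian (L ^ (K + 1 + 1)) M (aK a L (K + 1 + 1)) (((L ^ (K + 1 + 1) : ℕ) : ℝ) ^ 2) m2 *ᵥ φ) with hBq
  have h0 : 0 ≤ φ ⬝ᵥ φ := dotProduct_self_nonneg_real φ
  rw [← sub_div, abs_div, abs_two] at hdiff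
  have hd : |A - Bq| ≤ θa * (φ ⬝ᵥ φ) := by linarith
  have hφA : φ ⬝ᵥ φ ≤ A / γ₀ := by rw [le_div_iff₀ hγ]; linarith
  have hφB : φ ⬝ᵥ φ ≤ Bq / γ₀ := by rw [le_div_iff₀ hγ]; linarith
  have h1 := (abs_le.1 hd).1
  have h2 := (abs_le.1 hd).2
  constructor
  · calc Bq ≤ A + θa * (φ ⬝ᵥ φ) := by linarith
      _ ≤ A + θa * (A / γ₀) := by gcongr
      _ = (1 + θa / γ₀) * A := by ring
  · calc A ≤ Bq + θa * (φ ⬝ᵥ φ) := by linarith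
      _ ≤ Bq + θa * (Bq / γ₀) := by gcongr
      _ = (1 + θa / γ₀) * Bq := by ring

/-- **★★ THE LOCAL TWO-RUN BOUND AT KING'S OPERATORS** [folklore ∘ §1 + `relClose_king`]: run A = `Δ^{(K+1)}`, run B = `Δ^{(K+2)}` on the FULL unit-lattice field space `Tor M → ℝ`;
`W` bounded measurable and LOCAL on the site set `X ⊆ Tor M` (`W φ` depends on `φ|_X` only).  Then for every source `t`
`|log Z_B(t) − log Z_A(t) − (log Z_B(0) − log Z_A(0))| ≤ (e^{2|t|B} − 1)·θ_{K+1}·a·|X|∕(2γ₀)` — p518223's `abs_log_sub_log_sub_le_king` with `|Tor M|` REPLACED BY `|X|`: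
the NE7 remainder of a local observable does not see the volume. -/
theorem abs_log_sub_log_sub_le_kingLocal {a : ℝ} (ha : 0 < a) {L : ℕ} [NeZero L] (hL : 2 ≤ L) {m2 : ℝ} (hm : 0 < m2) (X : Finset (Tor M))
    (hWm : Measurable W) (hWb : ∀ φ, |W φ| ≤ B) (hWloc : ∀ φ ψ : Tor M → ℝ, (∀ x ∈ X, φ x = ψ x) → W φ = W ψ) (K : ℕ) (t : ℝ) :
    |Real.log (∫ φ : Tor M → ℝ, Real.exp (-(φ ⬝ᵥ (effLaplacian (L ^ (K + 1 + 1)) M (aK a L (K + 1 + 1)) (((L ^ (K + 1 + 1) : ℕ) : ℝ) ^ 2) m2 *ᵥ φ) / 2))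
          * Real.exp (t * W φ))
        - Real.log (∫ φ : Tor M → ℝ, Real.exp (-(φ ⬝ᵥ (effLaplacian (L ^ (K + 1)) M (aK a L (K + 1)) (((L ^ (K + 1) : ℕ) : ℝ) ^ 2) m2 *ᵥ φ) / 2))
          * Real.exp (t * W φ))
        - (Real.log (∫ φ : Tor M → ℝ, Real.exp (-(φ ⬝ᵥ (effLaplacian (L ^ (K + 1 + 1)) M (aK a L (K + 1 + 1)) (((L ^ (K + 1 + 1) : ℕ) : ℝ) ^ 2) m2 *ᵥ φ) / 2))
              * Real.exp (0 * W φ))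
            - Real.log (∫ φ : Tor M → ℝ, Real.exp (-(φ ⬝ᵥ (effLaplacian (L ^ (K + 1)) M (aK a L (K + 1)) (((L ^ (K + 1) : ℕ) : ℝ) ^ 2) m2 *ᵥ φ) / 2))
              * Real.exp (0 * W φ)))|
      ≤ (Real.exp (2 * (|t| * B)) - 1) * (thetaK a L (K + 1) 1 * a) * X.card / (2 * ((aminL a L)⁻¹ + m2⁻¹)⁻¹) := by
  have hγ := gamma0_pos ha hL hm
  have hθ : 0 ≤ thetaK a L (K + 1) 1 * a := mul_nonneg (kingTheta_nonneg ha hL (by omega) le_rfl) ha.le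
  have hε : 0 ≤ thetaK a L (K + 1) 1 * a / ((aminL a L)⁻¹ + m2⁻¹)⁻¹ := div_nonneg hθ hγ.le
  have h := abs_log_sub_log_sub_le_local (Equiv.sumCompl fun x => x ∈ X) hγ hε
    (effLaplacian_coercive_unif M ha hL (k := K + 1) (by omega) hm) (effLaplacian_coercive_unif M ha hL (k := K + 1 + 1) (by omega) hm)
    (fun φ => (relClose_king M ha hL hm K φ).1) (fun φ => (relClose_king M ha hL hm K φ).2) hWb (measurable_comp_extend M X hWm)
    (local_read_sumCompl M X hWloc) t
  rw [Fintype.card_coe] at h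
  refine h.trans (le_of_eq ?_)
  field_simp

/-- **★★ NE7's `MatchingModConstants` FOR LOCAL OBSERVABLES IN KING'S GAUSSIAN MODEL WITH A VOLUME-FREE REMAINDER** [folklore ∘ `abs_log_sub_log_sub_le_kingLocal`]:
`Z K t = ∫ exp(−½φ·Δ^{(K+1)}φ)·e^{tWφ} dφ` over the whole field space, `W` local on `X`, bounded measurable; then `MatchingModConstants vol l₀ δ Z` with
`δ_K = (e^{2l₀B} − 1)·θ_{K+1}·a·|X|∕(2γ₀·vol)` — compare `matchingModConstants_kingFullSpace` (p518223): the same constant with `|Tor M|`. -/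
theorem matchingModConstants_kingLocal {a : ℝ} (ha : 0 < a) {L : ℕ} [NeZero L] (hL : 2 ≤ L) {m2 : ℝ} (hm : 0 < m2) (hvol : 0 < vol) (X : Finset (Tor M))
    (hWm : Measurable W) (hWb : ∀ φ, |W φ| ≤ B) (hWloc : ∀ φ ψ : Tor M → ℝ, (∀ x ∈ X, φ x = ψ x) → W φ = W ψ)
    (hZ : ∀ K (t : ℝ), Z K t = ∫ φ : Tor M → ℝ,
      Real.exp (-(φ ⬝ᵥ (effLaplacian (L ^ (K + 1)) M (aK a L (K + 1)) (((L ^ (K + 1) : ℕ) : ℝ) ^ 2) m2 *ᵥ φ) / 2)) * Real.exp (t * W φ)) :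
    MatchingModConstants vol l₀
      (fun K => (Real.exp (2 * (l₀ * B)) - 1) * (thetaK a L (K + 1) 1 * a) * X.card / (2 * ((aminL a L)⁻¹ + m2⁻¹)⁻¹) / vol) Z := by
  intro K
  refine ⟨Real.log (Z (K + 1) 0) - Real.log (Z K 0), fun t ht => ?_⟩
  have hγ := gamma0_pos ha hL hm
  have hB : 0 ≤ B := (abs_nonneg _).trans (hWb fun _ => 0)
  have hθ : 0 ≤ thetaK a L (K + 1) 1 * a := mul_nonneg (kingTheta_nonneg ha hL (by omega) le_rfl) ha.le
  have hexp : Real.exp (2 * (|t| * B)) - 1 ≤ Real.exp (2 * (l₀ * B)) - 1 :=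
    sub_le_sub_right (Real.exp_le_exp.2 (by nlinarith [abs_nonneg t])) 1
  have hcard : (0 : ℝ) ≤ X.card := Nat.cast_nonneg _
  rw [hZ (K + 1) t, hZ K t, hZ (K + 1) 0, hZ K 0]
  calc _ ≤ (Real.exp (2 * (|t| * B)) - 1) * (thetaK a L (K + 1) 1 * a) * X.card / (2 * ((aminL a L)⁻¹ + m2⁻¹)⁻¹) :=
        abs_log_sub_log_sub_le_kingLocal M ha hL hm X hWm hWb hWloc K t
    _ ≤ (Real.exp (2 * (l₀ * B)) - 1) * (thetaK a L (K + 1) 1 * a) * X.card / (2 * ((aminL a L)⁻¹ + m2⁻¹)⁻¹) := by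
        gcongr
    _ = vol * ((Real.exp (2 * (l₀ * B)) - 1) * (thetaK a L (K + 1) 1 * a) * X.card / (2 * ((aminL a L)⁻¹ + m2⁻¹)⁻¹) / vol) := by
        field_simp

omit hM in
/-- … with a SUMMABLE volume-free remainder (`θ_{K+1}` geometric: n14-c's `summable_kingRadius`). [folklore] -/
theorem summable_delta_kingLocal {a : ℝ} (ha : 0 < a) {L : ℕ} (hL : 2 ≤ L) (m2 l₀ vol B : ℝ) (X : Finset (Tor M)) :
    Summable fun K : ℕ =>
      (Real.exp (2 * (l₀ * B)) - 1) * (thetaK a L (K + 1) 1 * a) * X.card / (2 * ((aminL a L)⁻¹ + m2⁻¹)⁻¹) / vol := by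
  have h := ((summable_kingRadius ha hL (n := 1) le_rfl (M := (1 : ℝ)) zero_le_one 0).1.mul_left
    ((Real.exp (2 * (l₀ * B)) - 1) * X.card / ((aminL a L)⁻¹ + m2⁻¹)⁻¹ / vol))
  refine h.congr fun K => ?_
  ring

/-- **NODE U5's `Spine.NE7.Target` INHABITED BY NAME, with the volume-free remainder**: `Target vol l₀ δ^{loc} Z` for the full-space King tower dressed by a local observable
[folklore ∘ the two theorems above] — a non-trivial (t-dependent, K-dependent) inhabitant of the node's target shape in the tree's own letters. -/
theorem target_kingLocal {a : ℝ} (ha : 0 < a) {L : ℕ} [NeZero L] (hL : 2 ≤ L) {m2 : ℝ} (hm : 0 < m2) (hvol : 0 < vol) (X : Finset (Tor M))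
    (hWm : Measurable W) (hWb : ∀ φ, |W φ| ≤ B) (hWloc : ∀ φ ψ : Tor M → ℝ, (∀ x ∈ X, φ x = ψ x) → W φ = W ψ)
    (hZ : ∀ K (t : ℝ), Z K t = ∫ φ : Tor M → ℝ,
      Real.exp (-(φ ⬝ᵥ (effLaplacian (L ^ (K + 1)) M (aK a L (K + 1)) (((L ^ (K + 1) : ℕ) : ℝ) ^ 2) m2 *ᵥ φ) / 2)) * Real.exp (t * W φ)) :
    Target vol l₀ (fun K => (Real.exp (2 * (l₀ * B)) - 1) * (thetaK a L (K + 1) 1 * a) * X.card / (2 * ((aminL a L)⁻¹ + m2⁻¹)⁻¹) / vol) Z :=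
  ⟨matchingModConstants_kingLocal M ha hL hm hvol X hWm hWb hWloc hZ, summable_delta_kingLocal M ha hL m2 l₀ vol B X⟩

/-- **★★★ THE CAUCHY PROPERTY OF THE GENERATING FUNCTIONS OF A LOCAL OBSERVABLE IN KING'S FULL-SPACE GAUSSIAN MODEL, WITH A VOLUME-FREE RATE** [folklore ∘ the two theorems
above + `T4CauchySum.cauchySeq_genFun` ∕ `tendstoUniformlyOn_genFun`]: hypotheses = the model's data (`a, m² > 0`, `L ≥ 2`), `vol > 0`, `l₀ ≥ 0`, a bounded measurable `W` LOCAL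
on `X` ONLY; conclusions = NE7 `MatchingModConstants vol l₀ δ Z` with `Σ δ_K < ∞`, `CauchySeq (K ↦ genFun Z K t)` on the window and uniform convergence there — with
`δ_K ∝ |X|` (the support of the observable), uniformly in the torus `Tor M`.  p518223's `cauchy_genFun_kingFullSpace` is the same statement with `δ_K ∝ |Tor M|`.  HONEST:
King's `A = 0` scalar MODEL; NOT Bałaban's NE7; count-neutral. -/
theorem cauchy_genFun_kingLocal {a : ℝ} (ha : 0 < a) {L : ℕ} [NeZero L] (hL : 2 ≤ L) {m2 : ℝ} (hm : 0 < m2) (hvol : 0 < vol) (hl₀ : 0 ≤ l₀) (X : Finset (Tor M))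
    (hWm : Measurable W) (hWb : ∀ φ, |W φ| ≤ B) (hWloc : ∀ φ ψ : Tor M → ℝ, (∀ x ∈ X, φ x = ψ x) → W φ = W ψ)
    (hZ : ∀ K (t : ℝ), Z K t = ∫ φ : Tor M → ℝ,
      Real.exp (-(φ ⬝ᵥ (effLaplacian (L ^ (K + 1)) M (aK a L (K + 1)) (((L ^ (K + 1) : ℕ) : ℝ) ^ 2) m2 *ᵥ φ) / 2)) * Real.exp (t * W φ)) :
    MatchingModConstants vol l₀
        (fun K => (Real.exp (2 * (l₀ * B)) - 1) * (thetaK a L (K + 1) 1 * a) * X.card / (2 * ((aminL a L)⁻¹ + m2⁻¹)⁻¹) / vol) Z ∧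
      (Summable fun K : ℕ =>
        (Real.exp (2 * (l₀ * B)) - 1) * (thetaK a L (K + 1) 1 * a) * X.card / (2 * ((aminL a L)⁻¹ + m2⁻¹)⁻¹) / vol) ∧
      (∀ t : ℝ, |t| ≤ l₀ → CauchySeq fun K => genFun Z K t) ∧
      TendstoUniformlyOn (fun K t => genFun Z K t) (genFunLim Z) atTop {t | |t| ≤ l₀} := by
  have hMC := matchingModConstants_kingLocal M ha hL hm hvol X hWm hWb hWloc (l₀ := l₀) hZ
  have hS := summable_delta_kingLocal M ha hL m2 l₀ vol B X
  exact ⟨hMC, hS, fun t ht => cauchySeq_genFun hMC hl₀ hS ht, tendstoUniformlyOn_genFun hMC hl₀ hS⟩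

/-- **A2 (inhabitation), exhibited**: the single-site observable `W φ = cos φ(x₀)` is bounded by `1`, measurable and local on `X = {x₀}`, so `cauchy_genFun_kingLocal` applies with
NO hypothesis beyond the model's data — NE7's `MatchingModConstants` + `Σδ < ∞` + Cauchy + uniform convergence with `δ_K = (e^{2l₀} − 1)·θ_{K+1}a∕(2γ₀vol)`, one site's worth,
whatever the torus `Tor M`. [folklore] -/
theorem cauchy_genFun_kingLocal_cos_site {a : ℝ} (ha : 0 < a) {L : ℕ} [NeZero L] (hL : 2 ≤ L) {m2 : ℝ} (hm : 0 < m2) (hvol : 0 < vol) (hl₀ : 0 ≤ l₀) (x₀ : Tor M)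
    (hZ : ∀ K (t : ℝ), Z K t = ∫ φ : Tor M → ℝ,
      Real.exp (-(φ ⬝ᵥ (effLaplacian (L ^ (K + 1)) M (aK a L (K + 1)) (((L ^ (K + 1) : ℕ) : ℝ) ^ 2) m2 *ᵥ φ) / 2)) * Real.exp (t * Real.cos (φ x₀))) :
    MatchingModConstants vol l₀ (fun K => (Real.exp (2 * l₀) - 1) * (thetaK a L (K + 1) 1 * a) / (2 * ((aminL a L)⁻¹ + m2⁻¹)⁻¹) / vol) Z ∧
      (Summable fun K : ℕ => (Real.exp (2 * l₀) - 1) * (thetaK a L (K + 1) 1 * a) / (2 * ((aminL a L)⁻¹ + m2⁻¹)⁻¹) / vol) ∧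
      (∀ t : ℝ, |t| ≤ l₀ → CauchySeq fun K => genFun Z K t) ∧
      TendstoUniformlyOn (fun K t => genFun Z K t) (genFunLim Z) atTop {t | |t| ≤ l₀} := by
  have h := cauchy_genFun_kingLocal M ha hL hm hvol hl₀ ({x₀} : Finset (Tor M)) (W := fun φ : Tor M → ℝ => Real.cos (φ x₀)) (B := 1)
    (Real.continuous_cos.measurable.comp (measurable_pi_apply x₀)) (fun φ => Real.abs_cos_le_one _)
    (fun φ ψ hX => by simp only [hX x₀ (Finset.mem_singleton_self x₀)]) hZ
  simpa only [Finset.card_singleton, Nat.cast_one, mul_one] using h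

/-- **★ N19's `Spine.NE7.Core` WITH ONE CLASS, NO BAD CLASS AND A VOLUME-FREE `δ`** for a local observable in King's full-space Gaussian model [folklore ∘ `matchingModConstants_kingLocal` +
`T4CauchySum.two_sided_of_abs_log_sub_le`]. -/
theorem core_kingLocal {a : ℝ} (ha : 0 < a) {L : ℕ} [NeZero L] (hL : 2 ≤ L) {m2 : ℝ} (hm : 0 < m2) (hvol : 0 < vol) (X : Finset (Tor M)) (hWm : Measurable W)
    (hWb : ∀ φ, |W φ| ≤ B) (hWloc : ∀ φ ψ : Tor M → ℝ, (∀ x ∈ X, φ x = ψ x) → W φ = W ψ) :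
    Core l₀ vol (fun _ => (Finset.univ : Finset Unit)) (fun _ _ => (∅ : Finset Unit))
      (fun K t _ => ∫ φ : Tor M → ℝ,
        Real.exp (-(φ ⬝ᵥ (effLaplacian (L ^ (K + 1)) M (aK a L (K + 1)) (((L ^ (K + 1) : ℕ) : ℝ) ^ 2) m2 *ᵥ φ) / 2)) * Real.exp (t * W φ))
      (fun K t _ => ∫ φ : Tor M → ℝ,
        Real.exp (-(φ ⬝ᵥ (effLaplacian (L ^ (K + 1 + 1)) M (aK a L (K + 1 + 1)) (((L ^ (K + 1 + 1) : ℕ) : ℝ) ^ 2) m2 *ᵥ φ) / 2)) * Real.exp (t * W φ))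
      fun K => (Real.exp (2 * (l₀ * B)) - 1) * (thetaK a L (K + 1) 1 * a) * X.card / (2 * ((aminL a L)⁻¹ + m2⁻¹)⁻¹) / vol := by
  have hγ := gamma0_pos ha hL hm
  have hMC := matchingModConstants_kingLocal M ha hL hm hvol X hWm hWb hWloc (l₀ := l₀)
    (Z := fun K t => ∫ φ : Tor M → ℝ,
      Real.exp (-(φ ⬝ᵥ (effLaplacian (L ^ (K + 1)) M (aK a L (K + 1)) (((L ^ (K + 1) : ℕ) : ℝ) ^ 2) m2 *ᵥ φ) / 2)) * Real.exp (t * W φ))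
    (fun K t => rfl)
  intro K
  obtain ⟨c, hc⟩ := hMC K
  refine ⟨c, fun t ht τ _ => two_sided_of_abs_log_sub_le ?_ ?_ (hc t ht)⟩
  · exact YMDAG.N18.KingModelLargeField.dressedZ_full_pos M hγ (effLaplacian_coercive_unif M ha hL (by omega) hm) hWm hWb t
  · exact YMDAG.N18.KingModelLargeField.dressedZ_full_pos M hγ (effLaplacian_coercive_unif M ha hL (by omega) hm) hWm hWb t

/-- **THE K3 KEYED-CORE-EDGE CONCLUSION SHAPE `∃ δ, Core … δ ∧ Summable δ`, INHABITED WITH A VOLUME-FREE `δ`** for a local observable in King's Gaussian model [folklore ∘ the two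
theorems above] — p518223's `exists_core_summable_kingFullSpace` with `|Tor M| ↦ |X|`. -/
theorem exists_core_summable_kingLocal {a : ℝ} (ha : 0 < a) {L : ℕ} [NeZero L] (hL : 2 ≤ L) {m2 : ℝ} (hm : 0 < m2) (hvol : 0 < vol) (X : Finset (Tor M))
    (hWm : Measurable W) (hWb : ∀ φ, |W φ| ≤ B) (hWloc : ∀ φ ψ : Tor M → ℝ, (∀ x ∈ X, φ x = ψ x) → W φ = W ψ) :
    ∃ δ : ℕ → ℝ, Core l₀ vol (fun _ => (Finset.univ : Finset Unit)) (fun _ _ => (∅ : Finset Unit))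
      (fun K t _ => ∫ φ : Tor M → ℝ,
        Real.exp (-(φ ⬝ᵥ (effLaplacian (L ^ (K + 1)) M (aK a L (K + 1)) (((L ^ (K + 1) : ℕ) : ℝ) ^ 2) m2 *ᵥ φ) / 2)) * Real.exp (t * W φ))
      (fun K t _ => ∫ φ : Tor M → ℝ,
        Real.exp (-(φ ⬝ᵥ (effLaplacian (L ^ (K + 1 + 1)) M (aK a L (K + 1 + 1)) (((L ^ (K + 1 + 1) : ℕ) : ℝ) ^ 2) m2 *ᵥ φ) / 2)) * Real.exp (t * W φ)) δ ∧
      (Summable δ ∧ ∀ K, δ K ≤ (Real.exp (2 * (l₀ * B)) - 1) * (thetaK a L (K + 1) 1 * a) * X.card / (2 * ((aminL a L)⁻¹ + m2⁻¹)⁻¹) / vol) :=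
  ⟨_, core_kingLocal M ha hL hm hvol X hWm hWb hWloc, summable_delta_kingLocal M ha hL m2 l₀ vol B X, fun _ => le_rfl⟩

/-- **★★ THE SPINE's NE7 ASSEMBLY `HybridNE7` INHABITED BY KING'S FULL-SPACE GAUSSIAN MODEL WITH NO BAD CLASS, NO FIAT AND A VOLUME-FREE `δ`** for a local observable
[folklore ∘ `matchingModConstants_kingLocal` + `T4MatchingAssembly.hybridNE7_noShell` + n14-c's `relWeightBound_empty`] — p519444's `hybridNE7_kingFullSpace` with `|Tor M| ↦ |X|`. -/
theorem hybridNE7_kingLocal {a : ℝ} (ha : 0 < a) {L : ℕ} [NeZero L] (hL : 2 ≤ L) {m2 : ℝ} (hm : 0 < m2) (hvol : 0 < vol) (X : Finset (Tor M)) (hWm : Measurable W)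
    (hWb : ∀ φ, |W φ| ≤ B) (hWloc : ∀ φ ψ : Tor M → ℝ, (∀ x ∈ X, φ x = ψ x) → W φ = W ψ)
    (hZ : ∀ K (t : ℝ), Z K t = ∫ φ : Tor M → ℝ,
      Real.exp (-(φ ⬝ᵥ (effLaplacian (L ^ (K + 1)) M (aK a L (K + 1)) (((L ^ (K + 1) : ℕ) : ℝ) ^ 2) m2 *ᵥ φ) / 2)) * Real.exp (t * W φ)) :
    HybridNE7 l₀ vol (fun _ => (Finset.univ : Finset Unit)) (fun K t _ => Z K t) (fun K t _ => Z (K + 1) t) (fun _ _ => (∅ : Finset Unit)) (fun _ => 0)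
      (fun _ _ _ => 0) (fun _ _ _ => 0) (fun _ => 0)
      fun K => (Real.exp (2 * (l₀ * B)) - 1) * (thetaK a L (K + 1) 1 * a) * X.card / (2 * ((aminL a L)⁻¹ + m2⁻¹)⁻¹) / vol := by
  have hγ := gamma0_pos ha hL hm
  have hZpos : ∀ K (t : ℝ), 0 < Z K t := fun K t => by
    rw [hZ K t]
    exact YMDAG.N18.KingModelLargeField.dressedZ_full_pos M hγ (effLaplacian_coercive_unif M ha hL (by omega) hm) hWm hWb t
  have hMC := matchingModConstants_kingLocal M ha hL hm hvol X hWm hWb hWloc (l₀ := l₀) hZ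
  refine hybridNE7_noShell relWeightBound_empty (fun K t _ _ _ => (hZpos K t).le) (fun K t _ _ _ => (hZpos (K + 1) t).le)
    (summable_delta_kingLocal M ha hL m2 l₀ vol B X) fun K => ?_
  obtain ⟨c, hc⟩ := hMC K
  exact ⟨c, fun t ht τ _ => two_sided_of_abs_log_sub_le (hZpos K t) (hZpos (K + 1) t) (hc t ht)⟩

end King

end Summit.QuantumFields.YangMills.BalabanUVNodes.N19TiltPathKingModelLocal

end
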